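import Mathlib
import HarnessLib
import Summits.RiemannHypothesis.RiemannHypothesis.Theses.WeilParity
import Summits.RiemannHypothesis.RiemannHypothesis.Theorems.WeilGroundStateGroundStateSimpleEvenCellTransfer
import Literature.NumberTheory.LFunctions.WeilGroundEnergyParitySplit

/-!
# Line `cells` — skeleton for the piece `OnePrimeWindowSimpleEven` (stmt-RiemannHypothesis-18084)
# of route WeilParity: the one-prime parity theorem from FOUR CELL CERTIFICATES

Piece (route leaf, child of the crux `EvenWinsBeyondArch`): for every window
`(log 2)/2 < a ≤ (log 3)/2` — exactly one prime power, `2`, enters Weil's windowed form — the bottom of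
the form is simple, isolated and even, `WeilWindowSimpleEven a`.  RH-FREE.

## THE LINE: cell transfer on the grid `(log 2)/2 < 2/5 < 9/20 < 1/2 < (log 3)/2`

Both sector bottoms are ANTITONE in the window, so on a cell `[b, c]` the odd-sector gap at every
`a ∈ [b, c]` follows from ONE inequality between the two ENDPOINTS, `ε(b) < ε_od(c)`: for an odd
normalised window-`a` test `g` (a window-`c` test), `Re Q(g) ≥ ε_od(c) > ε(b) ≥ ε(a)`; the landed
halving theorem of the sister crux (`GroundStateSimpleEven.weilWindowSimpleEven_on_cell_of_le`,
`Theorems/WeilGroundStateGroundStateSimpleEvenCellTransfer.lean` +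
`…OfOddSectorGap.lean`: odd gap ⟹ simple, isolated, even bottom) then gives `WeilWindowSimpleEven a`.
No continuity in `a`, no lower bound for the even complement.  Each stub below is ONE certificate
pair: an even trial function at the left endpoint `b` (closed-form Rayleigh quotient, any precision:
`ε(b) ≤ Re Q(e)`) against a certified LOWER bound for the odd sector at the right endpoint `c`
(Galerkin block + tail bounds with the prime-2 comb term `(log 2)·2^{-1/2}·(g(·+log 2)+g(·−log 2))`
in the kernel, cf. `WeilFirstPrimeCertificate*` and item 1529's `WeilGapCert`).

Numerics behind the grid (sister `Cruxes/GroundStateSimpleEven/Disproof.lean`, kit j016728/j016733,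
trig-Galerkin N = 22–38, mpmath): `a : e1, o1/e1` = `(log 2)/2 : 1.33e-3, 55` · `0.4 : 1.81e-4, 81` ·
`0.5 : 9.35e-7, 208` · `0.6 : 1.62e-9, 370`; law `ln e1(a) ≈ −4π e^{2a} + 9a + 15.8 (±0.4)` on
`[0.5, 1]`.  Cell margins `ε_od(c)/ε(b)`: cell 1 `[log2/2, 2/5]`: 1.47e-2 / 1.33e-3 ≈ 11 (both
measured); cell 2 `[2/5, 9/20]`: ≈2e-3 / 1.8e-4 ≈ 11; cell 3 `[9/20, 1/2]`: 1.9e-4 / ≈1.5e-5 ≈ 13;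
cell 4 `[1/2, log3/2]`: ≈1.2e-5 / 9.35e-7 ≈ 13 (interpolated values have a factor-3 uncertainty; every
margin stays > 2).  Why four cells and not one: `ε_od((log 3)/2) ≈ 1e-5 < ε((log 2)/2) = 1.3e-3`, so a
single cell fails; width ≈ 0.05 keeps a factor ≈ 10.

Hardest stub: `stub_cell4` (certified odd lower bound ≈ 1e-5 absolute at `c = (log 3)/2`).
The composition needs NO facts about `log 2`, `log 3` beyond `0 < (log 2)/2` (coverage is a case split
of `a` against the rational grid points).  Disproof used: none exists for this piece or its parent
(`ledger crux ls`, 2026-08-17).  Dead lines: none.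
-/

set_option linter.dupNamespace false
set_option linter.unusedVariables false

noncomputable section

namespace Summit.RiemannHypothesis.RiemannHypothesis.Cruxes.OnePrimeWindowSimpleEven.Cells

open MeasureTheory Set Filter
open scoped Real Topology
open Literature.NumberTheory.LFunctions
open Summit.RiemannHypothesis.RiemannHypothesis.Theses.WeilParity
open Summit.RiemannHypothesis.RiemannHypothesis.Theorems

/-! ## The four registered stubs — one certificate pair per cell -/

/-- **Cell 1, `[(log 2)/2, 2/5]`**: `ε((log 2)/2) < ε_od(2/5)` (numerically 1.33e-3 < 1.47e-2).
Even trial at the archimedean window (item 1529's `g₀` serves) against a certified odd-sector lower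
bound at window `2/5` with the prime-2 term. [cite: Bombieri2000Weil, §4 Thm. 5 (p. 197)] -/
theorem stub_cell1 : weilGroundEnergy (Real.log 2 / 2) < weilOddGroundEnergy (2 / 5) := by
  sorry

/-- **Cell 2, `[2/5, 9/20]`**: `ε(2/5) < ε_od(9/20)` (numerically 1.8e-4 < ≈2e-3).
[cite: Bombieri2000Weil, §4 Thm. 5 (p. 197)] -/
theorem stub_cell2 : weilGroundEnergy (2 / 5) < weilOddGroundEnergy (9 / 20) := by
  sorry

/-- **Cell 3, `[9/20, 1/2]`**: `ε(9/20) < ε_od(1/2)` (numerically ≈1.5e-5 < 1.9e-4).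
[cite: Bombieri2000Weil, §4 Thm. 5 (p. 197)] -/
theorem stub_cell3 : weilGroundEnergy (9 / 20) < weilOddGroundEnergy (1 / 2) := by
  sorry

/-- **Cell 4, `[1/2, (log 3)/2]`**: `ε(1/2) < ε_od((log 3)/2)` (numerically 9.35e-7 < ≈1.2e-5): the
hardest certificate (odd lower bound at the 1e-5 level). [cite: Bombieri2000Weil, §4 Thm. 5 (p. 197)] -/
theorem stub_cell4 : weilGroundEnergy (1 / 2) < weilOddGroundEnergy (Real.log 3 / 2) := by
  sorry

/-! ## Sorry-free infrastructure -/

/-- **One endpoint inequality gives the clause on the whole cell**: for `0 < b`, `ε(b) < ε_od(c)` and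
`a ∈ [b, c]` imply `WeilWindowSimpleEven a` — the landed cell transfer
`GroundStateSimpleEven.weilWindowSimpleEven_on_cell_of_le` with `U := ε(b)`, `L := ε_od(c)`
(`weilOddGroundEnergy_le` supplies the odd lower bound at window `c`). [folklore] -/
theorem weilWindowSimpleEven_of_cell {b c a : ℝ} (hb : 0 < b)
    (hcell : weilGroundEnergy b < weilOddGroundEnergy c) (hba : b ≤ a) (hac : a ≤ c) :
    WeilWindowSimpleEven a :=
  GroundStateSimpleEven.weilWindowSimpleEven_on_cell_of_le hb hcell le_rfl
    (fun g hg hs hn ho ↦ weilOddGroundEnergy_le hg hs ho hn) hba hac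

/-- `0 < (log 2)/2`. [folklore] -/
theorem log_two_half_pos : 0 < Real.log 2 / 2 :=
  div_pos (Real.log_pos one_lt_two) two_pos

/-! ## The composition: the four cells prove the piece BY NAME -/

/-- **Composition with explicit hypotheses** (`cell₁ → cell₂ → cell₃ → cell₄ → piece unfolded`): case
split of `a ∈ ((log 2)/2, (log 3)/2]` against the grid points `2/5, 9/20, 1/2` and
`weilWindowSimpleEven_of_cell` on the cell containing `a`. Sorry-free. [folklore] -/
theorem onePrimeWindowSimpleEven_of_stubs
    (h₁ : weilGroundEnergy (Real.log 2 / 2) < weilOddGroundEnergy (2 / 5))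
    (h₂ : weilGroundEnergy (2 / 5) < weilOddGroundEnergy (9 / 20))
    (h₃ : weilGroundEnergy (9 / 20) < weilOddGroundEnergy (1 / 2))
    (h₄ : weilGroundEnergy (1 / 2) < weilOddGroundEnergy (Real.log 3 / 2)) :
    ∀ a : ℝ, Real.log 2 / 2 < a → a ≤ Real.log 3 / 2 →
      Literature.NumberTheory.LFunctions.WeilWindowSimpleEven a := by
  intro a ha hle
  rcases le_or_gt a (2 / 5) with ha1 | ha1
  · exact weilWindowSimpleEven_of_cell log_two_half_pos h₁ ha.le ha1
  rcases le_or_gt a (9 / 20) with ha2 | ha2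
  · exact weilWindowSimpleEven_of_cell (by norm_num) h₂ ha1.le ha2
  rcases le_or_gt a (1 / 2) with ha3 | ha3
  · exact weilWindowSimpleEven_of_cell (by norm_num) h₃ ha2.le ha3
  · exact weilWindowSimpleEven_of_cell (by norm_num) h₄ ha3.le hle

/-- **THE SKELETON THEOREM.** The piece
`Summit.RiemannHypothesis.RiemannHypothesis.Theses.WeilParity.OnePrimeWindowSimpleEven`, concluded BY
NAME from the four DECLARED cell stubs (the only `sorry`s of the file) through the sorry-free
composition `onePrimeWindowSimpleEven_of_stubs`. [folklore] -/
theorem OnePrimeWindowSimpleEven_of :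
    Summit.RiemannHypothesis.RiemannHypothesis.Theses.WeilParity.OnePrimeWindowSimpleEven :=
  onePrimeWindowSimpleEven_of_stubs stub_cell1 stub_cell2 stub_cell3 stub_cell4

end Summit.RiemannHypothesis.RiemannHypothesis.Cruxes.OnePrimeWindowSimpleEven.Cells

end
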